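import Summits.CriticalPhenomena.SAWScalingLimit.Theorems.SAWDevelopingMapObservableToSLETypeLadderCarvedReductionSqueezeZoneBulk
import Summits.CriticalPhenomena.SAWScalingLimit.Theorems.SAWDevelopingMapObservableToSLETypeLadderCarvedReductionSqueezeLimitUnion
import HarnessLib

/-!
# The limit structure of one side of the carving (piece (T-A′₂F side structure) of stub T-A′₂F
# `stub_carvedReduction_squeezeGeometry_domainsCoreF`)

Crux `SAWDevelopingMap.ObservableToSLE` (stmt-CriticalPhenomena-10472), line `six-class-type-ladder`,
stub T-A′₂F `stub_carvedReduction_squeezeGeometry_domainsCoreF`.  Landing target: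
`Summits/CriticalPhenomena/SAWScalingLimit/Theorems/SAWDevelopingMapObservableToSLETypeLadderCarvedReductionSqueezeSideStructure.lean`.

For ONE side of the squeeze (removed levels `L j` exactly the tracked cells `g j a`, pinned
centres `→ C a`, radii `→ ϱ a`, persistence, the exact window at the gate `P`, the spine `Ksp`
and body `Bd` with their persistence clauses, the connectors `Cc, ϱc`, the roots and locality)
`sideStructure` collects the facts about the union `X = ⋃ₐ hex(C a, ϱ a)` of the closed limit cells
that the bulk `Ω` and the zones consume: `X` is closed, connected, contains the limit root `α`,
lies in `closedBall α R`; every point of `X` is eventually `ε`-close to pinned removed vertices;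
the open lower half-window, the spine and body cores, the open connectors, hence the unshrunk zone
`sideZone P ρ Ksp Bd cell conn 0`, lie in `X`; and `X` misses the open upper half-window.  All by
the limit lemmas of `…SqueezeLimitCover`, `…SqueezeLimitUnion`, `…SqueezeGateStructure`.
Registered carrier: `stub_carvedReduction_sideStructure`.
-/

noncomputable section

open scoped Topology
open Filter Set Metric
open Literature.Probability.LatticeModels (HexVertex hexGraph hexCenter triEmbed Site)
open Literature.Probability.RandomPlanarGeometry

namespace Summit.CriticalPhenomena.SAWScalingLimit.Theorems.ObservableToSLE.TypeLadder

open Summit.CriticalPhenomena.SAWScalingLimit.Theorems.ObservableToSLER.BridgeGate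

/-- A closed skew hexagon is closed. -/
theorem isClosed_skewHexAbs (C₀ : ℂ) (ϱ₀ : ℝ) : IsClosed {z : ℂ | ∀ ℓ : Fin 3, |skewCoord ℓ (z - C₀)| ≤ ϱ₀} := by
  have h : {z : ℂ | ∀ ℓ : Fin 3, |skewCoord ℓ (z - C₀)| ≤ ϱ₀} = ⋂ ℓ : Fin 3, {z : ℂ | |skewCoord ℓ (z - C₀)| ≤ ϱ₀} := by
    ext z; simp
  rw [h]
  exact isClosed_iInter fun ℓ =>
    isClosed_le (continuous_abs.comp ((continuous_skewCoord ℓ).comp (continuous_id.sub continuous_const))) continuous_const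

/-- **THE LIMIT STRUCTURE OF ONE SIDE**; see the module docstring.  Pinned points are
`ṽ = s_j c_v - s_j triEmbed (x j)`. -/
theorem sideStructure {N : ℕ} {s : ℕ → ℝ} {x : ℕ → Site 2} {L : ℕ → Set HexVertex} {g : ℕ → Fin N → HexVertex × ℕ}
    {C Cc : Fin N → ℂ} {ϱ ϱc : Fin N → ℝ} {q root : ℕ → HexVertex} {P α : ℂ} {Ksp Bd : Set ℂ} {R ρ : ℝ}
    (hs : ∀ j, 0 < s j) (hs0 : Tendsto s atTop (𝓝 0)) (hϱ0 : ∀ a, 0 ≤ ϱ a)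
    (hL : ∀ j (v : HexVertex), v ∈ L j ↔ ∃ a, v ∈ hexBall (g j a).1 (g j a).2)
    (hC : ∀ a, Tendsto (fun j => (s j : ℂ) * hexCenter (g j a).1 - (s j : ℂ) * triEmbed (x j)) atTop (𝓝 (C a)))
    (hϱ : ∀ a, Tendsto (fun j => s j * ((g j a).2 + 1 / 2)) atTop (𝓝 (ϱ a)))
    (hpers : ∀ ε > (0 : ℝ), ∀ᶠ j in atTop, ∀ (a : Fin N) (v : HexVertex),
      (∀ ℓ : Fin 3, |skewCoord ℓ ((s j : ℂ) * hexCenter v - (s j : ℂ) * triEmbed (x j) - C a)| ≤ ϱ a - ε) → v ∈ L j)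
    (hconv : Tendsto (fun j => (s j : ℂ) * hexCenter (((q j).1 - x j, 0) : HexVertex)) atTop (𝓝 P))
    (hwin : ∀ᶠ j in atTop, ∀ v : HexVertex,
      (s j : ℂ) * hexCenter v - (s j : ℂ) * triEmbed (x j) ∈ ball P (ρ / 2) → (v ∈ L j ↔ v.1 1 < (q j).1 1))
    (hKper : ∀ ε > (0 : ℝ), ∀ᶠ j in atTop, ∀ v : HexVertex,
      infDist ((s j : ℂ) * hexCenter v - (s j : ℂ) * triEmbed (x j)) Ksp ≤ ρ / 8 - ε → v ∈ L j)
    (hBper : ∀ ε > (0 : ℝ), ∀ᶠ j in atTop, ∀ v : HexVertex,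
      infDist ((s j : ℂ) * hexCenter v - (s j : ℂ) * triEmbed (x j)) Bd ≤ ρ / 4 - ε → v ∈ L j)
    (hconnper : ∀ ε > (0 : ℝ), ∀ᶠ j in atTop, ∀ (a : Fin N) (v : HexVertex),
      (∀ ℓ : Fin 3, |skewCoord ℓ ((s j : ℂ) * hexCenter v - (s j : ℂ) * triEmbed (x j) - Cc a)| ≤ ϱc a - ε) → v ∈ L j)
    (hroot : ∀ j, root j ∈ L j)
    (hrootlim : Tendsto (fun j => (s j : ℂ) * hexCenter (root j) - (s j : ℂ) * triEmbed (x j)) atTop (𝓝 α))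
    (hpre : ∀ j, (hexGraph.induce (L j)).Preconnected)
    (hloc : ∀ j, ∀ v ∈ L j, dist ((s j : ℂ) * hexCenter v) ((s j : ℂ) * hexCenter (root j)) ≤ R) :
    IsClosed (⋃ a, {z : ℂ | ∀ ℓ : Fin 3, |skewCoord ℓ (z - C a)| ≤ ϱ a}) ∧
    (∀ a (z : ℂ), (∀ ℓ : Fin 3, |skewCoord ℓ (z - C a)| ≤ ϱ a) → dist z α ≤ R) ∧
    (∀ ε > (0 : ℝ), ∀ᶠ j in atTop, ∀ (a : Fin N) (z : ℂ), (∀ ℓ : Fin 3, |skewCoord ℓ (z - C a)| ≤ ϱ a) →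
      ∃ v ∈ L j, dist ((s j : ℂ) * hexCenter v - (s j : ℂ) * triEmbed (x j)) z < ε) ∧
    (∀ z : ℂ, dist z P < ρ / 2 → P.im < z.im → z ∉ ⋃ a, {z : ℂ | ∀ ℓ : Fin 3, |skewCoord ℓ (z - C a)| ≤ ϱ a}) ∧
    IsConnected (⋃ a, {z : ℂ | ∀ ℓ : Fin 3, |skewCoord ℓ (z - C a)| ≤ ϱ a}) ∧
    α ∈ (⋃ a, {z : ℂ | ∀ ℓ : Fin 3, |skewCoord ℓ (z - C a)| ≤ ϱ a}) ∧
    {z : ℂ | infDist z Ksp < ρ / 8} ⊆ (⋃ a, {z : ℂ | ∀ ℓ : Fin 3, |skewCoord ℓ (z - C a)| ≤ ϱ a}) ∧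
    {z : ℂ | infDist z Bd < ρ / 4} ⊆ (⋃ a, {z : ℂ | ∀ ℓ : Fin 3, |skewCoord ℓ (z - C a)| ≤ ϱ a}) ∧
    {z : ℂ | z.im < P.im} ∩ ball P (ρ / 2) ⊆ (⋃ a, {z : ℂ | ∀ ℓ : Fin 3, |skewCoord ℓ (z - C a)| ≤ ϱ a}) ∧
    sideZone P ρ Ksp Bd (fun a => (C a, ϱ a)) (fun a => (Cc a, ϱc a)) 0 ⊆
      (⋃ a, {z : ℂ | ∀ ℓ : Fin 3, |skewCoord ℓ (z - C a)| ≤ ϱ a}) := by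
  set X : Set ℂ := ⋃ a, {z : ℂ | ∀ ℓ : Fin 3, |skewCoord ℓ (z - C a)| ≤ ϱ a} with hX
  -- containment from the convergence of the cells
  have hcont := eventually_level_subset_thicken hs hs0 hL hC hϱ
  -- the tracked centres are removed
  have ht : ∀ᶠ j in atTop, ∀ a, (g j a).1 ∈ L j :=
    Eventually.of_forall fun j a => (hL j _).2 ⟨a, mem_hexBall_self _ _⟩
  -- (c) every point of `X` is eventually near removed vertices
  have hL2 := eventually_near_removed_of_mem_limitHex hs hs0 hpers ht hC
  -- (a) closedness
  have hXc : IsClosed X := isClosed_iUnion_of_finite fun a => isClosed_skewHexAbs (C a) (ϱ a)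
  -- (b) locality
  have hXR : ∀ a (z : ℂ), (∀ ℓ : Fin 3, |skewCoord ℓ (z - C a)| ≤ ϱ a) → dist z α ≤ R := by
    intro a z hz
    refine le_of_forall_pos_le_add fun ε hε => ?_
    have h1 := hL2 (ε / 2) (half_pos hε)
    have h2 : ∀ᶠ j in atTop, dist ((s j : ℂ) * hexCenter (root j) - (s j : ℂ) * triEmbed (x j)) α < ε / 2 :=
      (tendsto_iff_dist_tendsto_zero.1 hrootlim).eventually (gt_mem_nhds (half_pos hε))
    obtain ⟨j, hj1, hj2⟩ := (h1.and h2).exists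
    obtain ⟨v, hvL, hvz⟩ := hj1 a z hz
    have h3 : dist ((s j : ℂ) * hexCenter v - (s j : ℂ) * triEmbed (x j))
        ((s j : ℂ) * hexCenter (root j) - (s j : ℂ) * triEmbed (x j)) ≤ R := by
      rw [dist_sub_right]; exact hloc j v hvL
    calc dist z α ≤ dist z ((s j : ℂ) * hexCenter v - (s j : ℂ) * triEmbed (x j)) +
          dist ((s j : ℂ) * hexCenter v - (s j : ℂ) * triEmbed (x j)) α := dist_triangle _ _ _
      _ ≤ ε / 2 + (R + ε / 2) := by
          refine add_le_add (by rw [dist_comm]; exact hvz.le) ((dist_triangle _ _ _).trans (add_le_add h3 hj2.le))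
      _ = R + ε := by ring
  -- (g) the open upper half-window is off `X`
  have hup : ∀ z : ℂ, dist z P < ρ / 2 → P.im < z.im → z ∉ X := by
    intro z hz hzim hzX
    obtain ⟨a, ha⟩ := mem_iUnion.1 hzX
    have hpera : ∀ ε > (0 : ℝ), ∀ᶠ j in atTop, ∀ v : HexVertex,
        (∀ ℓ : Fin 3, |skewCoord ℓ ((s j : ℂ) * hexCenter v - (s j : ℂ) * triEmbed (x j) - C a)| ≤ ϱ a - ε) → v ∈ L j :=
      fun ε hε => (hpers ε hε).mono fun j hj v hv => hj a v hv
    have := gate_closedHexagon_below hs hs0 hconv hwin hpera (ht.mono fun j hj => hj a) (hC a) ha hz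
    linarith
  -- (h) connectedness and the root
  haveI : Nonempty (Fin N) := by
    obtain ⟨a, -⟩ := (hL 0 _).1 (hroot 0); exact ⟨a⟩
  have hXconn : IsConnected X := isConnected_iUnion_limitHex hs hs0 hL hpre hC hϱ hϱ0
  have hαX : α ∈ X := mem_iUnion_limitHex_of_tendsto hs hs0 hL hC hϱ (Eventually.of_forall hroot) hrootlim
  -- (e) the cores
  have hKX : {z : ℂ | infDist z Ksp < ρ / 8} ⊆ X := fun z hz =>
    mem_iUnion.2 (mem_limitHex_of_persistent_infDist hs hs0 hcont hKper hz)
  have hBX : {z : ℂ | infDist z Bd < ρ / 4} ⊆ X := fun z hz =>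
    mem_iUnion.2 (mem_limitHex_of_persistent_infDist hs hs0 hcont hBper hz)
  -- (d) the open lower half-window
  have hWX : {z : ℂ | z.im < P.im} ∩ ball P (ρ / 2) ⊆ X := fun z hz =>
    mem_iUnion.2 (mem_limitHex_of_lowerHalfWindow hs hs0 hcont hconv hwin (mem_ball.1 hz.2) hz.1)
  -- (f) the open connectors
  have hconnX : ∀ a, hexInt (Cc a) (ϱc a) 0 ⊆ X := by
    intro a z hz
    have hconna : ∀ ε > (0 : ℝ), ∀ᶠ j in atTop, ∀ v : HexVertex,
        (∀ ℓ : Fin 3, |skewCoord ℓ ((s j : ℂ) * hexCenter v - (s j : ℂ) * triEmbed (x j) - Cc a)| ≤ ϱc a - ε) → v ∈ L j :=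
      fun ε hε => (hconnper ε hε).mono fun j hj v hv => hj a v hv
    obtain ⟨η, hη, hrem⟩ := eventually_removed_near_of_mem_hexInt hconna hz
    exact mem_iUnion.2 (mem_limitHex_of_eventually_removed_near hs hs0 hcont hη hrem)
  refine ⟨hXc, hXR, hL2, hup, hXconn, hαX, hKX, hBX, hWX, ?_⟩
  -- (i) the unshrunk zone
  rintro z (((h | h) | h) | h)
  · refine hWX ⟨?_, ?_⟩
    · have := h.1; simp only [mem_setOf_eq, sub_zero] at this ⊢; exact this
    · have := h.2; simp only [sub_zero] at this ⊢; exact this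
  · exact hKX (by have : infDist z Ksp < ρ / 8 - 0 := h; simpa using this)
  · exact hBX (by have : infDist z Bd < ρ / 4 - 0 := h; simpa using this)
  · rw [mem_iUnion] at h
    obtain ⟨a, ha | ha⟩ := h
    · refine mem_iUnion.2 ⟨a, fun ℓ => ?_⟩
      have := ha ℓ; simp only [mul_zero, sub_zero] at this; exact this.le
    · exact hconnX a ha

/-- **Registered carrier `stub_carvedReduction_sideStructure`** (crux item stmt-CriticalPhenomena-10472,
stub T-A′₂F `stub_carvedReduction_squeezeGeometry_domainsCoreF`, piece THE SIDE STRUCTURE): a closed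
skew hexagon is closed. -/
theorem stub_carvedReduction_sideStructure :
    ∀ (C₀ : ℂ) (ϱ₀ : ℝ), IsClosed {z : ℂ | ∀ ℓ : Fin 3, |skewCoord ℓ (z - C₀)| ≤ ϱ₀} :=
  fun C₀ ϱ₀ => isClosed_skewHexAbs C₀ ϱ₀

end Summit.CriticalPhenomena.SAWScalingLimit.Theorems.ObservableToSLE.TypeLadder

end
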